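import Mathlib.Algebra.Category.ModuleCat.Topology.Homology
import Literature.Algebra.Homology.ContCohomologyCrossedHomClass
import HarnessLib

/-!
# A continuous crossed homomorphism with vanishing class in `H¹` is principal
# (Mathlib `continuousCohomology`)

Companion of `ContCohomologyCrossedHomClass.lean` (generic setting: a topological group `G`, a
topological ring `k`, a topological `k[G]`-module `X : TopRep k G`, Mathlib's homogeneous continuous
cochains and `continuousCohomology`).  There the class `crossedHomClass X f hf ∈ H¹(G, X)` of a continuous
crossed homomorphism `f : G → X` (`f (x y) = f x + x • f y`) is constructed and PRINCIPAL crossed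
homomorphisms `g ↦ g • v − v` are shown to have class `0` (`crossedHomClass_principal`).  This file proves
the CONVERSE, completing the classical description "`H¹(G, A)` = continuous crossed homomorphisms modulo
principal ones" [cite: SerreGaloisCohomology1997, I §2.3] for Mathlib's definition as the homology of the
homogeneous cochain complex in `TopModuleCat k`:

* `exists_toCycles_eq_of_π_eq_zero` — a `1`-cocycle whose image under `homologyπ` vanishes is `d⁰` of a
  `0`-cochain (the homology of `TopModuleCat` is computed by the CONCRETE cokernel
  `TopModuleCat.isColimitCoker`, compared with the abstract one through `homologyIsCokernel`);
* `exists_eq_sub_of_crossedHomClass_eq_zero` — if `[f] = 0` then `f g = g • v − v` for a vector `v` with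
  continuous orbit map (namely `v = σ(1)` for the bounding invariant `0`-cochain `σ`);
* `crossedHomClass_eq_zero_iff` — `[f] = 0 ↔ f` is principal;
* `eq_zero_of_crossedHomClass_eq_zero`, `crossedHomClass_ne_zero` — for a TRIVIAL action a crossed
  homomorphism (= continuous homomorphism) with class `0` is `0`; a nonzero one has nonzero class
  (`H¹(G, A) = Hom_cont(G, A)`, [cite: SerreGaloisCohomology1997, I §2.3]).

Generic; no anabelian content (written for the abc-iut cell's countermodels to universal closures of
`H¹`-exactness schemata, where a restriction class must be shown NONZERO).
-/

noncomputable section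

open CategoryTheory CategoryTheory.Limits TopRep ContRepresentation Topology

namespace ContinuousCohomology

universe u v w

variable {k : Type u} [Ring k] [TopologicalSpace k]
variable {G : Type v} [Group G] [TopologicalSpace G] [IsTopologicalGroup G]
variable (X : TopRep.{max v w} k G)

/-! ### Classes that vanish come from `0`-cochains -/

/-- A `1`-cocycle of the homogeneous cochain complex whose cohomology class vanishes is the image of a
`0`-cochain under `toCycles : C⁰ → Z¹` (i.e. a coboundary): Mathlib's `H¹ = (homogeneousCochains X).homology 1`
is a cokernel of `toCycles` (`homologyIsCokernel`), and in `TopModuleCat k` that cokernel is, up to the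
canonical comparison, the module quotient `Z¹ ⧸ range (toCycles)` (`TopModuleCat.isColimitCoker`).
[cite: SerreGaloisCohomology1997, I §2.3] -/
theorem exists_toCycles_eq_of_π_eq_zero (z : (homogeneousCochains X).cycles 1)
    (hz : ((homogeneousCochains X).homologyπ 1).hom z = 0) :
    ∃ σ : (homogeneousCochains X).X 0, ((homogeneousCochains X).toCycles 0 1).hom σ = z := by
  have hc := (homogeneousCochains X).homologyIsCokernel 0 1 (by simp)
  have hc' := TopModuleCat.isColimitCoker ((homogeneousCochains X).toCycles 0 1)
  have hcomm := IsColimit.comp_coconePointUniqueUpToIso_hom hc hc' WalkingParallelPair.one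
  rw [Cofork.app_one_eq_π, Cofork.app_one_eq_π, Cofork.π_ofπ, Cofork.π_ofπ] at hcomm
  have hcomm' : (homogeneousCochains X).homologyπ 1 ≫ (hc.coconePointUniqueUpToIso hc').hom =
      TopModuleCat.cokerπ ((homogeneousCochains X).toCycles 0 1) := hcomm
  have h2 := congrArg (fun φ => TopModuleCat.Hom.hom φ z) hcomm'
  change (hc.coconePointUniqueUpToIso hc').hom.hom (((homogeneousCochains X).homologyπ 1).hom z) =
    (TopModuleCat.cokerπ ((homogeneousCochains X).toCycles 0 1)).hom z at h2
  rw [hz] at h2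
  have h3 : (TopModuleCat.cokerπ ((homogeneousCochains X).toCycles 0 1)).hom z = 0 := by
    rw [← h2]
    exact map_zero _
  exact (Submodule.Quotient.mk_eq_zero _).mp h3

/-- Unfolding the action of `G` on `0`-cochains: an invariant `σ : C(G, X)` satisfies
`g • σ(g⁻¹ x) = σ x`. [cite: SerreGaloisCohomology1997, I §2.3] -/
theorem zeroCochain_invariant_apply (σ : (homogeneousCochains X).X 0) (g x : G) :
    X.ρ g (σ.1 (g⁻¹ * x)) = σ.1 x :=
  congrArg (fun c : C(G, X) => c x) (σ.2 g)

/-- Hence an invariant `0`-cochain is the orbit map of its value at `1`: `σ g = g • σ 1`.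
[cite: SerreGaloisCohomology1997, I §2.3] -/
theorem zeroCochain_apply_eq (σ : (homogeneousCochains X).X 0) (g : G) :
    σ.1 g = X.ρ g (σ.1 1) := by
  have h := zeroCochain_invariant_apply X σ g g
  rw [inv_mul_cancel] at h
  exact h.symm

/-- The coboundary of a `0`-cochain, evaluated: `(d⁰ σ)(x)(y) = σ y − σ x`.
[cite: SerreGaloisCohomology1997, I §2.3] -/
theorem d_zeroCochain_apply (σ : (homogeneousCochains X).X 0) (x y : G) :
    (((homogeneousCochains X).d 0 1).hom σ).1 x y = σ.1 y - σ.1 x := by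
  have h := homogeneousCochains.d_apply X 0 σ
  rw [h]
  rfl

omit [IsTopologicalGroup G] in
/-- A crossed homomorphism vanishes at `1`. [cite: SerreGaloisCohomology1997, I §2.3] -/
theorem crossedHom_map_one (f : C(G, X)) (hf : ∀ x y, f (x * y) = f x + X.ρ x (f y)) :
    f 1 = 0 := by
  have h := hf 1 1
  rw [mul_one, map_one X.ρ, one_apply_eq_self] at h
  simpa using h

/-- **A continuous crossed homomorphism whose class in `H¹(G, X)` vanishes is principal**: there is
`v : X` with continuous orbit map and `f g = g • v − v` for all `g`. [cite: SerreGaloisCohomology1997, I §2.3] -/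
theorem exists_eq_sub_of_crossedHomClass_eq_zero (f : C(G, X))
    (hf : ∀ x y, f (x * y) = f x + X.ρ x (f y)) (h0 : crossedHomClass X f hf = 0) :
    ∃ v : X, (Continuous fun g : G => X.ρ g v) ∧ ∀ g, f g = X.ρ g v - v := by
  obtain ⟨σ, hσ⟩ := exists_toCycles_eq_of_π_eq_zero X (crossedHomCocycle X f hf) h0
  -- the cochain of `d⁰ σ` is `twoOf f`
  have hd : ((homogeneousCochains X).d 0 1).hom σ =
      ((homogeneousCochains X).iCycles 1).hom (crossedHomCocycle X f hf) := by
    rw [← hσ]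
    have h := congrArg (fun φ => φ.hom σ) ((homogeneousCochains X).toCycles_i 0 1)
    simp only [TopModuleCat.hom_comp, ContinuousLinearMap.coe_comp, Function.comp_apply] at h
    exact h.symm
  have hd1 : (((homogeneousCochains X).d 0 1).hom σ).1 = twoOf X f := by
    rw [hd, iCycles_crossedHomCocycle]
  have hev : ∀ y : G, f y = σ.1 y - σ.1 1 := by
    intro y
    have h : σ.1 y - σ.1 1 = f y - f 1 := by
      rw [← d_zeroCochain_apply, ← twoOf_apply X f 1 y, hd1]
    rw [crossedHom_map_one X f hf, sub_zero] at h
    exact h.symm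
  refine ⟨σ.1 1, ?_, fun g => ?_⟩
  · have hfun : (fun g : G => X.ρ g (σ.1 1)) = σ.1 := funext fun g => (zeroCochain_apply_eq X σ g).symm
    rw [hfun]
    exact σ.1.continuous
  · rw [hev g, zeroCochain_apply_eq X σ g]

/-- **`[f] = 0` in `H¹(G, X)` iff `f` is principal** (for continuous crossed homomorphisms, with the
bounding vector required to have a continuous orbit map). [cite: SerreGaloisCohomology1997, I §2.3] -/
theorem crossedHomClass_eq_zero_iff (f : C(G, X)) (hf : ∀ x y, f (x * y) = f x + X.ρ x (f y)) :
    crossedHomClass X f hf = 0 ↔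
      ∃ v : X, (Continuous fun g : G => X.ρ g v) ∧ ∀ g, f g = X.ρ g v - v := by
  refine ⟨exists_eq_sub_of_crossedHomClass_eq_zero X f hf, ?_⟩
  rintro ⟨v, hv, hfv⟩
  have hf' : f = ⟨fun g => X.ρ g v - v, hv.sub continuous_const⟩ := ContinuousMap.ext hfv
  subst hf'
  exact crossedHomClass_principal X v hv hf

/-! ### Trivial action: `H¹ = Hom`, so a nonzero homomorphism has nonzero class -/

/-- For a TRIVIAL action, a continuous crossed homomorphism (= continuous homomorphism) with vanishing
class is zero. [cite: SerreGaloisCohomology1997, I §2.3] -/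
theorem eq_zero_of_crossedHomClass_eq_zero (htriv : ∀ (g : G) (x : X), X.ρ g x = x) (f : C(G, X))
    (hf : ∀ x y, f (x * y) = f x + X.ρ x (f y)) (h0 : crossedHomClass X f hf = 0) : f = 0 := by
  obtain ⟨v, -, hfv⟩ := exists_eq_sub_of_crossedHomClass_eq_zero X f hf h0
  ext g
  rw [hfv g, htriv g v, sub_self, ContinuousMap.zero_apply]

/-- For a TRIVIAL action, a continuous homomorphism that does not vanish identically has NONZERO class in
`H¹(G, X)`. [cite: SerreGaloisCohomology1997, I §2.3] -/
theorem crossedHomClass_ne_zero (htriv : ∀ (g : G) (x : X), X.ρ g x = x) (f : C(G, X))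
    (hf : ∀ x y, f (x * y) = f x + X.ρ x (f y)) {g : G} (hg : f g ≠ 0) :
    crossedHomClass X f hf ≠ 0 := by
  intro h0
  apply hg
  rw [eq_zero_of_crossedHomClass_eq_zero X htriv f hf h0, ContinuousMap.zero_apply]

end ContinuousCohomology

end
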